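import Mathlib.RingTheory.DedekindDomain.SelmerGroup
import Mathlib.Order.LiminfLimsup
import Literature.NumberTheory.EllipticCurves.BSDSelmerCMPConverseCMField
import Literature.NumberTheory.EllipticCurves.QuadraticTwistSelmerPInfty
import Literature.NumberTheory.EllipticCurves.LFunctionSmulProofs
import HarnessLib

/-!
# Burungale–Tian, Ann. of Math. 203 (2026), §3.2.2: the quadratic twist family over the CM field
# (Theorem 3.5 = Bhargava–Klagsbrun–Lemke Oliver–Shnidman; Proposition 1.3)

A. A. Burungale, Y. Tian, *A rank zero `p`-converse to a theorem of Gross–Zagier, Kolyvagin and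
Rubin*, Ann. of Math. (2) **203** (2026), no. 1, 1–13 = arXiv:2506.03465v2, §1 Prop. 1.3 and
§3.2.2 Thm. 3.5 (the two statements of the paper about quadratic twists `E^{(t)}`,
`t ∈ K^×/(K^×)²`, of a CM curve over its CM field `K`; the companion of
`BSDSelmerCMPConverseCMField` (Thm. 1.1 as printed) and `BSDSelmerCMPConverseGoldfeldPrintedProofs`
(Thm. 1.2 / Thm. 3.3 over `ℚ`), which left them untyped for want of the density convention on
`K^×/(K^×)²`):

> **Theorem 3.5.** Let `E` be an elliptic curve defined over an imaginary quadratic field `K`, with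
> CM by an order of `K`. Suppose that `3` is not inert in `K`. Then for at least `50%` of
> `t ∈ K^×/(K^×)²`, `corank_{ℤ₃} Sel_{3^∞}(E^{(t)}/K) = 0`. ("The proof of Proposition 1.3 utilises
> the following [1, Thm. 2.7]" — [1] = Bhargava–Klagsbrun–Lemke Oliver–Shnidman, Duke Math. J. 168
> (2019); their Thm. 2.7 prints "at least `50%` of twists `E_s` have rank `0`", obtained in their
> §9.2 through `Sel_3(E_s) = 0`, whence the Selmer form printed by Burungale–Tian.)
>
> **Proposition 1.3.** Same hypotheses. Then for at least `50%` of `t ∈ K^×/(K^×)²`,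
> `ord_{s=1} L(s, E^{(t)}/K) = 0`. ("Proof of Proposition 1.3. This is a consequence of Theorem 3.5
> and the `3`-converse Theorem 1.1.")

What this file fixes as VOCABULARY (definitions with bodies, Mathlib's own square-class quotient):
* `SquareClass K = K^× ⧸ (K^×)²` (`Kˣ ⧸ (powMonoidHom 2).range`, the quotient of Mathlib's
  `IsDedekindDomain.selmerGroup` file);
* `squareClassHeight t = H(t) = ∏_{𝔭 : v_𝔭(t) odd} N𝔭` — the height of Bhargava–Klagsbrun–Lemke
  Oliver–Shnidman 2019, §2 ("We define the height `H(s)` of `s ∈ F^*/F^{*2}` by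
  `H(s) := ∏_{𝔭 : v_𝔭(s) is odd} N(𝔭)`"; "`Σ(X) := {s ∈ Σ : H(s) < X}`. If `F = ℚ`, then `Σ(X)` consists
  of the squareclasses of all squarefree integers of absolute value less than `X`"), written with
  Mathlib's `HeightOneSpectrum.valuationOfNeZeroMod 2 : K^×/(K^×)² →* Multiplicative (ZMod 2)`
  (`v_𝔭 mod 2`, already a function of the square class);
* `SquareClassProportionGe P δ` = "for at least (a proportion) `δ` of `t ∈ K^×/(K^×)²`, `P(t)`", read —
  as in [1] Thm. 2.5/2.7 ("the proportion of twists … is at least") — as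
  `δ ≤ liminf_{X → ∞} #{t : H(t) < X, P(t)} / #{t : H(t) < X}` (the twists ordered by `H`; both
  counts are finite, the junk `Nat.card = 0` never occurs);
* `TwistClassSatisfies V P t` = "`P` holds for the twist `E^{(t)}`": for EVERY representative
  `s ∈ t`, `P (V.quadraticTwist s)` (`E^{(t)}` is a `K`-isomorphism class: `E^{(s u²)} ≅_K E^{(s)}`,
  tree `exists_variableChange_quadraticTwist_mul_sq`; for the two properties used here the choice
  of representative is immaterial — PROVED below: `selmerCorank_quadraticTwist_eq_of_mk_eq`,
  `analyticRank_quadraticTwist_eq_of_mk_eq`).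

And as NAMED FACTS (refereed, Annals 2026): `burungaleTian_thm35_selmerCorank_three_twists` and
`burungaleTian_prop13_analyticRank_twists`. The printed one-line proof of Prop. 1.3 is not
replayed in the kernel: it needs, besides Thm. 3.5 and Thm. 1.1
(`burungaleTian_analyticRank_eq_zero_of_selmerCorank_eq_zero_of_hasRationalCM`), that `E^{(t)}`
again has CM by an order of `K` over `K` (twist-stability of `HasRationalCM`, not in the tree) and
the finiteness of `{t : H(t) < X}` (to compare the two counting functions) — recorded, not assumed.
"CM by an order of `K`, defined over `K`" is transcribed `IsImaginaryQuadratic K ∧ V.HasRationalCM`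
exactly as in `BSDSelmerCMPConverseCMField`; "`3` is not inert in `K`" = the ideal `3𝓞_K` is not
prime.

## References

* [BurungaleTian2026] A. A. Burungale, Y. Tian, Ann. of Math. (2) 203 (2026) 1–13 =
  arXiv:2506.03465v2: Prop. 1.3 (p. 2), §3.2.2 Thm. 3.5 and "Proof of Proposition 1.3", Rem. 3.6
  (p. 7).
* [BhargavaKlagsbrunLemkeOliverShnidman2019] M. Bhargava, Z. Klagsbrun, R. J. Lemke Oliver,
  A. Shnidman, *`3`-isogeny Selmer groups and ranks of abelian varieties in quadratic twist families
  over a number field*, Duke Math. J. 168 (2019), no. 15, 2951–2989 = arXiv:1709.09790: §2 (height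
  `H(s)`, `Σ(X)`), Thm. 2.5, Thm. 2.7, §9.2.
-/

noncomputable section

open scoped Classical
open Filter Topology
open WeierstrassCurve IsDedekindDomain NumberField

universe u

namespace Literature.NumberTheory.EllipticCurves

/-! ## Square classes, the BKLOS height, and "at least `δ` of `t ∈ K^×/(K^×)²`" -/

section SquareClasses

variable (K : Type u) [Field K]

/-- **`K^×/(K^×)²`**, the group of square classes of a number field (Mathlib's
`Kˣ ⧸ (powMonoidHom 2).range`, the quotient carrying `HeightOneSpectrum.valuationOfNeZeroMod 2`
and `IsDedekindDomain.selmerGroup`). Bhargava–Klagsbrun–Lemke Oliver–Shnidman 2019, §2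
("squareclass `s ∈ F^*/F^{*2}`"); Burungale–Tian 2026, Prop. 1.3 ("`t ∈ K^×/(K^×)²`").
[cite: BhargavaKlagsbrunLemkeOliverShnidman2019, §2] -/
abbrev SquareClass : Type u :=
  Kˣ ⧸ (powMonoidHom 2 : Kˣ →* Kˣ).range

variable {K}

/-- **"`P` holds for the quadratic twist `E^{(t)}`", `t ∈ K^×/(K^×)²`** (Burungale–Tian 2026,
Prop. 1.3: `E^{(t)}`; BKLOS 2019, §2: "For any squareclass `s ∈ F^*/F^{*2}`, the quadratic twist
`A_s`"): `P (V.quadraticTwist s)` for every representative `s ∈ K^×` of the class `t` — the twist is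
a `K`-isomorphism class (`E^{(s u²)} ≅_K E^{(s)}`, `exists_variableChange_quadraticTwist_mul_sq`),
and for isomorphism-invariant `P` (e.g. `selmerCorank`, `analyticRank`:
`selmerCorank_quadraticTwist_eq_of_mk_eq`, `analyticRank_quadraticTwist_eq_of_mk_eq`) "every"
and "some representative" agree. [cite: BurungaleTian2026, Prop. 1.3 (the twists `E^{(t)}`)] -/
def TwistClassSatisfies (V : WeierstrassCurve K) (P : WeierstrassCurve K → Prop)
    (t : SquareClass K) : Prop :=
  ∀ s : Kˣ, (QuotientGroup.mk s : SquareClass K) = t → P (V.quadraticTwist (s : K))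

variable [NumberField K]

/-- **The height `H(t) = ∏_{𝔭 : v_𝔭(t) odd} N(𝔭)` of a square class** (Bhargava–Klagsbrun–Lemke
Oliver–Shnidman, Duke Math. J. 168 (2019), §2: "We define the height `H(s)` of `s ∈ F^*/F^{*2}` by
`H(s) := ∏_{𝔭 : v_𝔭(s) is odd} N(𝔭)`"): the product, over the finite primes `v` of `K` at which the
class has odd valuation (`v.valuationOfNeZeroMod 2 t ≠ 1` in `Multiplicative (ZMod 2)`), of the
absolute norms `N(v) = #(𝓞_K/v)`; a finite product (`finprod`; only the finitely many primes in the
support of a representative can contribute). For `K = ℚ` and `t` the class of a squarefree integer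
`d` this is `|d|`. [cite: BhargavaKlagsbrunLemkeOliverShnidman2019, §2 (definition of `H(s)`)] -/
def squareClassHeight (t : SquareClass K) : ℕ :=
  ∏ᶠ v : HeightOneSpectrum (𝓞 K),
    if v.valuationOfNeZeroMod 2 t = 1 then 1 else Ideal.absNorm v.asIdeal

/-- **"For at least (a proportion) `δ` of `t ∈ K^×/(K^×)²`, `P(t)`"** (Burungale–Tian 2026,
Prop. 1.3 / Thm. 3.5: "for at least `50%` of `t ∈ K^×/(K^×)²`"; Bhargava–Klagsbrun–Lemke
Oliver–Shnidman 2019, §2 and Thm. 2.5/2.7: square classes ordered by the height `H`,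
`Σ(X) = {s : H(s) < X}`, "the proportion of twists `E_s` having rank `0` is at least …"): the lower
proportion `liminf_{X → ∞} #{t : H(t) < X ∧ P(t)} / #{t : H(t) < X}` is at least `δ` (`X` along `ℕ`;
the sets are finite — finitely many square classes of bounded height — so `Nat.card` is the honest
count). [cite: BurungaleTian2026, Prop. 1.3 and Thm. 3.5 ("for at least 50% of t ∈ K×/(K×)²")]
[cite: BhargavaKlagsbrunLemkeOliverShnidman2019, §2 (`Σ(X)`), Thm. 2.5] -/
def SquareClassProportionGe (P : SquareClass K → Prop) (δ : ℝ) : Prop :=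
  δ ≤ liminf (fun X : ℕ ↦
    (Nat.card {t : SquareClass K | squareClassHeight t < X ∧ P t} : ℝ) /
      Nat.card {t : SquareClass K | squareClassHeight t < X}) atTop

end SquareClasses

/-! ## The two printed statements (named facts) -/

/-- **Burungale–Tian, Ann. of Math. 203 (2026), Theorem 3.5** (= Bhargava–Klagsbrun–Lemke
Oliver–Shnidman, Duke Math. J. 168 (2019), Thm. 2.7 with §9.2, in the Selmer form printed by
Burungale–Tian): "Let `E` be an elliptic curve defined over an imaginary quadratic field `K`, with
CM by an order of `K`. Suppose that `3` is not inert in `K`. Then for at least `50%` of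
`t ∈ K^×/(K^×)²`, `corank_{ℤ₃} Sel_{3^∞}(E^{(t)}/K) = 0`." Transcription: `K : Type` imaginary
quadratic (`IsImaginaryQuadratic K`); "defined over `K` with CM by an order of `K`" =
`V : WeierstrassCurve K` elliptic with `V.HasRationalCM` (as in
`burungaleTian_analyticRank_eq_zero_of_selmerCorank_eq_zero_of_hasRationalCM`); "`3` is not inert
in `K`" = the ideal `3𝓞_K` is not a prime ideal; "for at least `50%` of `t`" =
`SquareClassProportionGe … (1/2)` (BKLOS height ordering, lower proportion); the twist property via
`TwistClassSatisfies` with `P E = (E.selmerCorank 3 = 0)`. REFEREED (Annals; the cited BKLOS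
theorem is refereed, Duke). [cite: BurungaleTian2026, Thm. 3.5 (§3.2.2, p. 7)]
[cite: BhargavaKlagsbrunLemkeOliverShnidman2019, Thm. 2.7 and §9.2] -/
def burungaleTian_thm35_selmerCorank_three_twists : Prop :=
  ∀ (K : Type) [Field K] [NumberField K], IsImaginaryQuadratic K →
    ¬ (Ideal.span ({3} : Set (𝓞 K))).IsPrime →
    ∀ (V : WeierstrassCurve K) [V.IsElliptic], V.HasRationalCM →
      SquareClassProportionGe
        (TwistClassSatisfies V fun E : WeierstrassCurve K ↦ E.selmerCorank 3 = 0) (1 / 2)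

/-- **Burungale–Tian, Ann. of Math. 203 (2026), Proposition 1.3** (p. 2): "Let `E` be an elliptic
curve defined over an imaginary quadratic field `K`, with CM by an order of `K`. Suppose that `3`
is not inert in `K`. Then for at least `50%` of `t ∈ K^×/(K^×)²`, `ord_{s=1} L(s, E^{(t)}/K) = 0`."
Printed proof (p. 7): "This is a consequence of Theorem 3.5 and the `3`-converse Theorem 1.1"
(tree: `burungaleTian_thm35_selmerCorank_three_twists`,
`burungaleTian_analyticRank_eq_zero_of_selmerCorank_eq_zero_of_hasRationalCM` at `p = 3`, applied
to each `E^{(t)}`, which again has CM by an order of `K` over `K`). Transcription as in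
`burungaleTian_thm35_selmerCorank_three_twists`, with `P E = (E.analyticRank = 0)`
(`ord_{s=1} L(s, E/K)` = `WeierstrassCurve.analyticRank`, as in the Thm. 1.1 binder). By Rem. 3.6:
(i) the cube-sum curves `x³ + y³ = 2n` over `K = ℚ(ζ₃)` satisfy the hypotheses; (ii) "a positive
proportion of the quadratic twists in Proposition 1.3 do not descend to `ℚ`". REFEREED.
[cite: BurungaleTian2026, Prop. 1.3 (p. 2) and its proof (§3.2.2, p. 7), Rem. 3.6] -/
def burungaleTian_prop13_analyticRank_twists : Prop :=
  ∀ (K : Type) [Field K] [NumberField K], IsImaginaryQuadratic K →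
    ¬ (Ideal.span ({3} : Set (𝓞 K))).IsPrime →
    ∀ (V : WeierstrassCurve K) [V.IsElliptic], V.HasRationalCM →
      SquareClassProportionGe
        (TwistClassSatisfies V fun E : WeierstrassCurve K ↦ E.analyticRank = 0) (1 / 2)

/-! ## API: unfolding, the trivial class, independence of the representative -/

section API

variable {K : Type u} [Field K]

/-- Unfolding `TwistClassSatisfies`. [cite: BurungaleTian2026, Prop. 1.3] -/
theorem twistClassSatisfies_iff (V : WeierstrassCurve K) (P : WeierstrassCurve K → Prop)
    (t : SquareClass K) :
    TwistClassSatisfies V P t ↔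
      ∀ s : Kˣ, (QuotientGroup.mk s : SquareClass K) = t → P (V.quadraticTwist (s : K)) :=
  Iff.rfl

/-- Two representatives of the same square class differ by a square: `s' = s · u²`.
[cite: BhargavaKlagsbrunLemkeOliverShnidman2019, §2] -/
theorem exists_eq_mul_sq_of_mk_eq {s s' : Kˣ}
    (h : (QuotientGroup.mk s : SquareClass K) = QuotientGroup.mk s') :
    ∃ u : Kˣ, s' = s * u ^ 2 := by
  rw [QuotientGroup.eq] at h
  obtain ⟨u, hu⟩ := h
  refine ⟨u, ?_⟩
  rw [powMonoidHom_apply] at hu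
  rw [hu, mul_inv_cancel_left]

/-- For an isomorphism-invariant property the "every representative" reading of
`TwistClassSatisfies` is equivalent to the "some representative" reading.
[cite: BurungaleTian2026, Prop. 1.3] -/
theorem twistClassSatisfies_iff_exists (V : WeierstrassCurve K) (P : WeierstrassCurve K → Prop)
    (hP : ∀ s s' : Kˣ, (QuotientGroup.mk s : SquareClass K) = QuotientGroup.mk s' →
      (P (V.quadraticTwist (s : K)) ↔ P (V.quadraticTwist (s' : K))))
    (t : SquareClass K) :
    TwistClassSatisfies V P t ↔
      ∃ s : Kˣ, (QuotientGroup.mk s : SquareClass K) = t ∧ P (V.quadraticTwist (s : K)) := by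
  constructor
  · intro h
    obtain ⟨s, rfl⟩ := QuotientGroup.mk_surjective t
    exact ⟨s, rfl, h s rfl⟩
  · rintro ⟨s, rfl, hs⟩ s' hs'
    exact (hP s s' hs'.symm).mp hs

variable [NumberField K]

/-- Unfolding `SquareClassProportionGe`. [cite: BurungaleTian2026, Prop. 1.3] -/
theorem squareClassProportionGe_iff (P : SquareClass K → Prop) (δ : ℝ) :
    SquareClassProportionGe P δ ↔
      δ ≤ liminf (fun X : ℕ ↦
        (Nat.card {t : SquareClass K | squareClassHeight t < X ∧ P t} : ℝ) /
          Nat.card {t : SquareClass K | squareClassHeight t < X}) atTop :=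
  Iff.rfl

/-- The trivial square class has height `1` (no prime has odd valuation).
[cite: BhargavaKlagsbrunLemkeOliverShnidman2019, §2] -/
theorem squareClassHeight_one : squareClassHeight (1 : SquareClass K) = 1 := by
  unfold squareClassHeight
  simp

/-- **The `p^∞`-Selmer corank of `E^{(t)}` does not depend on the representative of `t`**:
`E^{(s u²)} ≅_K E^{(s)}` (`exists_variableChange_quadraticTwist_mul_sq`) and isomorphic curves have
equal Selmer coranks (`selmerCorank_eq_of_variableChange`). So in Thm. 3.5 "for every
representative" = "for some representative". [cite: BurungaleTian2026, Thm. 3.5] -/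
theorem selmerCorank_quadraticTwist_eq_of_mk_eq (V : WeierstrassCurve K) (p : ℕ) {s s' : Kˣ}
    (h : (QuotientGroup.mk s : SquareClass K) = QuotientGroup.mk s') :
    (V.quadraticTwist (s : K)).selmerCorank p = (V.quadraticTwist (s' : K)).selmerCorank p := by
  obtain ⟨u, rfl⟩ := exists_eq_mul_sq_of_mk_eq h
  obtain ⟨C, hC⟩ := V.exists_variableChange_quadraticTwist_mul_sq (s : K) (u : K) u.ne_zero
  rw [Units.val_mul, Units.val_pow_eq_pow_val]
  exact selmerCorank_eq_of_variableChange p hC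

/-- **The analytic rank of `E^{(t)}` does not depend on the representative of `t`** (for `V`
elliptic: `analyticRank_smul`, `isElliptic_quadraticTwist`). So in Prop. 1.3 "for every
representative" = "for some representative". [cite: BurungaleTian2026, Prop. 1.3] -/
theorem analyticRank_quadraticTwist_eq_of_mk_eq (V : WeierstrassCurve K) [V.IsElliptic] {s s' : Kˣ}
    (h : (QuotientGroup.mk s : SquareClass K) = QuotientGroup.mk s') :
    (V.quadraticTwist (s : K)).analyticRank = (V.quadraticTwist (s' : K)).analyticRank := by
  obtain ⟨u, rfl⟩ := exists_eq_mul_sq_of_mk_eq h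
  obtain ⟨C, hC⟩ := V.exists_variableChange_quadraticTwist_mul_sq (s : K) (u : K) u.ne_zero
  haveI : (V.quadraticTwist (s : K)).IsElliptic := V.isElliptic_quadraticTwist s.ne_zero
  rw [Units.val_mul, Units.val_pow_eq_pow_val, ← hC, analyticRank_smul]

/-- The Selmer-corank predicate of Thm. 3.5 in its "some representative" form.
[cite: BurungaleTian2026, Thm. 3.5] -/
theorem twistClassSatisfies_selmerCorank_iff_exists (V : WeierstrassCurve K) (p : ℕ)
    (t : SquareClass K) :
    TwistClassSatisfies V (fun E : WeierstrassCurve K ↦ E.selmerCorank p = 0) t ↔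
      ∃ s : Kˣ, (QuotientGroup.mk s : SquareClass K) = t ∧
        (V.quadraticTwist (s : K)).selmerCorank p = 0 :=
  twistClassSatisfies_iff_exists V _
    (fun _ _ h ↦ by rw [selmerCorank_quadraticTwist_eq_of_mk_eq V p h]) t

/-- The analytic-rank predicate of Prop. 1.3 in its "some representative" form (`V` elliptic).
[cite: BurungaleTian2026, Prop. 1.3] -/
theorem twistClassSatisfies_analyticRank_iff_exists (V : WeierstrassCurve K) [V.IsElliptic]
    (t : SquareClass K) :
    TwistClassSatisfies V (fun E : WeierstrassCurve K ↦ E.analyticRank = 0) t ↔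
      ∃ s : Kˣ, (QuotientGroup.mk s : SquareClass K) = t ∧
        (V.quadraticTwist (s : K)).analyticRank = 0 :=
  twistClassSatisfies_iff_exists V _
    (fun _ _ h ↦ by rw [analyticRank_quadraticTwist_eq_of_mk_eq V h]) t

end API

end Literature.NumberTheory.EllipticCurves

end
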